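import Literature.Probability.LatticeModels.FKPrimitiveLaplacian
import Literature.Probability.LatticeModels.InterfaceSLE
import Literature.Probability.LatticeModels.MeshDomainJordan
import HarnessLib

/-!
# Bulk geometry of square-lattice discretisations: deep edges are interior

Topic `Literature/Probability/LatticeModels`; an instalment (items K1–K2 of the road recorded in
`Sweep1Proofs.lean`, module docstring §2b) of the discharge programme for crit-ising.S18 /
Smirnov's Theorem 2.2. The bulk estimates of `FKObservableL2Bound.lean` are stated at edges all of
whose neighbouring edges are *interior* in Smirnov's sense (`IsInteriorEdge` of
`FKPrimitiveLaplacian.lean`: both faces inner, no endpoint on the discrete boundary arcs). This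
file proves that for a discretisation `E` of a Dobrushin domain `D` (`IsDiscretisation`, the
CDHKS rendering used by crit-ising.S17/S18) every compact `K ⊆ D` is eventually deep inside:
for all small `δ > 0`, all edges at all sites within any fixed lattice radius `R` of a site
whose mesh point lies in `K` are interior edges of `E δ`
(`IsDiscretisation.eventually_isInteriorEdge`) — Smirnov 2010, §5, first sentence of the proof of
Lemma 5.3 ("for `δ` small enough the squares of `Q` are interior squares of `Ω_δ`"). Everything is
proved.

* `DiscreteDobrushin.IsBulkRegion T` (sites of `Ω_δ`, neighbours joined in the mesh graph),
  `supNear` (sup-distance balls), `IsBulkRegion.isInnerFace_faceAt`,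
  `IsBulkRegion.not_mem_zdBoundary`, `IsBulkRegion.isInteriorEdge` (deterministic: edges three
  steps inside a bulk region are interior).
* `IsDiscretisation.eventually_isInteriorEdge`: by
  `JordanDomain.eventually_forall_mem_meshDomain'` (compacts of any Jordan domain are eventually
  covered by `meshDomain D δ`) applied to a closed thickening of `K` in `D`, whose lattice segments
  lie in `D̄`.

## References

* S. Smirnov, Ann. of Math. 172 (2010) 1435–1467, §3 ("interior vertices/squares") and §5 — bib
  key `Smirnov2010`.
-/

noncomputable section

namespace Literature.Probability.LatticeModels

open Filter _root_.Topology Metric Set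

/-! ### Deterministic: edges two steps inside a good region are interior -/

namespace DiscreteDobrushin

variable (E : DiscreteDobrushin)

/-- A set of sites `T` is a **bulk region** of the data `E` if its sites are vertices of `Ω_δ` and
neighbouring sites of `T` are joined in the mesh graph. [cite: Smirnov2010, §3 ("interior vertices")] -/
structure IsBulkRegion (T : Set (Site 2)) : Prop where
  subset_meshDomain : T ⊆ meshDomain E.Ω E.δ
  adj : ∀ v ∈ T, ∀ w ∈ T, (zdGraph 2).Adj v w → (meshGraph E.Ω E.δ).Adj v w

variable {E} {T : Set (Site 2)}

/-- Neighbours in a bulk region are adjacent in `Ω_δ`. [cite: Smirnov2010, §3] -/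
theorem IsBulkRegion.discreteAdj (hT : E.IsBulkRegion T) {v w : Site 2} (hv : v ∈ T) (hw : w ∈ T)
    (h : (zdGraph 2).Adj v w) : (discreteDomainGraph E.Ω E.δ).Adj v w :=
  discreteDomainGraph_adj_iff.2 ⟨hT.adj v hv w hw h, hT.subset_meshDomain hv, hT.subset_meshDomain hw⟩

/-- Sup-distance at most `r` from `y`. [folklore] -/
def supNear (y : Site 2) (r : ℤ) (z : Site 2) : Prop := ∀ i, |z i - y i| ≤ r

/-- `y` is within `r ≥ 0` of itself. [folklore] -/
theorem supNear_self (y : Site 2) {r : ℤ} (hr : 0 ≤ r) : supNear y r y := fun i => by simp [hr]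

/-- Monotonicity of `supNear` in the radius. [folklore] -/
theorem supNear_mono {y z : Site 2} {r r' : ℤ} (h : supNear y r z) (hrr' : r ≤ r') : supNear y r' z :=
  fun i => (h i).trans hrr'

/-- Corners of the faces around `v` are within sup-distance `1` of `v`. [folklore] -/
theorem supNear_of_isCorner_faceAt {v w : Site 2} {j : Fin 4} (hw : IsCorner w (faceAt v j)) : supNear v 1 w := by
  intro i
  have h := hw i
  have hf : (faceAt v j) i = v i - cornerOff j i := by simp [faceAt]
  have hc : cornerOff j i = 0 ∨ cornerOff j i = 1 := by fin_cases j <;> fin_cases i <;> simp [cornerOff]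
  rcases h with h | h <;> rcases hc with hc | hc <;> rw [hf, hc] at h <;> rw [h] <;> simp

/-- `zdGraph`-neighbours are within sup-distance `1`. [folklore] -/
theorem supNear_of_adj {v w : Site 2} (h : (zdGraph 2).Adj v w) : supNear v 1 w := by
  intro i
  rcases (zdGraph_adj_iff v w).1 h with ⟨i', rfl | h'⟩
  · by_cases hi : i = i' <;> simp [hi]
  · rw [h']; by_cases hi : i = i' <;> simp [hi]

/-- Triangle inequality for `supNear`. [folklore] -/
theorem supNear.trans {x y z : Site 2} {r s : ℤ} (hxy : supNear x r y) (hyz : supNear y s z) : supNear x (r + s) z := by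
  intro i
  have h1 := hxy i; have h2 := hyz i
  rw [abs_le] at h1 h2 ⊢; constructor <;> linarith [h1.1, h1.2, h2.1, h2.2]

/-- **All faces around a site one step inside a bulk region are inner.** [cite: Smirnov2010, §3] -/
theorem IsBulkRegion.isInnerFace_faceAt (hT : E.IsBulkRegion T) {v : Site 2} (hv : ∀ z, supNear v 1 z → z ∈ T)
    (j : Fin 4) : E.IsInnerFace (faceAt v j) := by
  intro a b ha hb hab
  exact hT.discreteAdj (hv a (supNear_of_isCorner_faceAt ha)) (hv b (supNear_of_isCorner_faceAt hb)) hab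

/-- **A site two steps inside a bulk region is not on the discrete boundary.** [cite: Smirnov2010, §3] -/
theorem IsBulkRegion.not_mem_zdBoundary (hT : E.IsBulkRegion T) {v : Site 2} (hv : ∀ z, supNear v 2 z → z ∈ T) :
    v ∉ E.zdBoundary := by
  have hv1 : ∀ z, supNear v 1 z → z ∈ T := fun z hz => hv z (supNear_mono hz (by norm_num))
  rw [mem_zdBoundary_iff, not_or]
  constructor
  · rw [mem_meshBoundary_iff, not_and]
    intro _
    push Not
    intro y hy
    exact hT.discreteAdj (hv1 v (supNear_self v zero_le_one)) (hv1 y (supNear_of_adj hy)) hy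
  · rintro ⟨w, -, -, f, hf, hvf, -⟩
    obtain ⟨j, rfl⟩ := exists_faceAt_of_isCorner hvf
    -- the faces around `v`'s... the face `faceAt v j` is inner: its corners are within `1` of `v`
    exact hf (hT.isInnerFace_faceAt (fun z hz => hv1 z hz) j)

/-- **Edges two steps inside a bulk region are interior** (`IsInteriorEdge`): both faces inner,
no endpoint on the discrete boundary (in particular not on the arcs). [cite: Smirnov2010, §3] -/
theorem IsBulkRegion.isInteriorEdge (hT : E.IsBulkRegion T) {y : Site 2} (hy : ∀ z, supNear y 3 z → z ∈ T)
    (k : Fin 4) : E.IsInteriorEdge y k := by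
  have hy1 : ∀ z, supNear y 1 z → z ∈ T := fun z hz => hy z (supNear_mono hz (by norm_num))
  have hyk : supNear y 1 (y + cornerUnit k) := by
    intro i; fin_cases i <;> fin_cases k <;> simp [cornerUnit]
  have hy' : ∀ z, supNear (y + cornerUnit k) 2 z → z ∈ T := fun z hz => by
    have := hyk.trans hz; norm_num at this; exact hy z this
  have hy2 : ∀ z, supNear y 2 z → z ∈ T := fun z hz => hy z (supNear_mono hz (by norm_num))
  have hnb : y ∉ E.zdBoundary := hT.not_mem_zdBoundary hy2
  have hnb' : y + cornerUnit k ∉ E.zdBoundary := hT.not_mem_zdBoundary hy'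
  refine ⟨?_, ?_, ?_, hT.isInnerFace_faceAt hy1 k, hT.isInnerFace_faceAt hy1 (k + 3)⟩
  · have hadj : (zdGraph 2).Adj y (y + cornerUnit k) := by
      rw [zdGraph_adj_iff]
      fin_cases k
      · exact ⟨0, Or.inl rfl⟩
      · exact ⟨1, Or.inl rfl⟩
      · exact ⟨0, Or.inr (by simp [cornerUnit])⟩
      · exact ⟨1, Or.inr (by simp [cornerUnit])⟩
    exact (SimpleGraph.mem_edgeSet _).2 (hT.discreteAdj (hy1 y (supNear_self y zero_le_one)) (hy1 _ hyk) hadj)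
  · intro x hx
    rw [cSrc] at hx
    rcases Sym2.mem_iff.1 hx with rfl | rfl
    · exact fun h => hnb (E.zdArcB_subset_zdBoundary h)
    · exact fun h => hnb' (E.zdArcB_subset_zdBoundary h)
  · exact fun h => hnb (E.zdArcA_subset_zdBoundary h.1)

/-- Mesh points of sites within sup-distance `s` are within `2 s δ`. [folklore] -/
theorem dist_meshPoint_le_of_supNear {δ : ℝ} (hδ : 0 ≤ δ) {v w : Site 2} {s : ℤ} (h : supNear v s w) :
    dist (meshPoint δ w) (meshPoint δ v) ≤ δ * (2 * s) := by
  rw [Complex.dist_eq]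
  refine (Complex.norm_le_abs_re_add_abs_im _).trans ?_
  simp only [Complex.sub_re, Complex.sub_im, meshPoint_re, meshPoint_im]
  have h0 := h 0
  have h1 := h 1
  have e0 : δ * (w 0 : ℝ) - δ * v 0 = δ * ((w 0 - v 0 : ℤ) : ℝ) := by push_cast; ring
  have e1 : δ * (w 1 : ℝ) - δ * v 1 = δ * ((w 1 - v 1 : ℤ) : ℝ) := by push_cast; ring
  rw [e0, e1, abs_mul, abs_mul, abs_of_nonneg hδ]
  have k0 : |((w 0 - v 0 : ℤ) : ℝ)| ≤ s := by exact_mod_cast h0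
  have k1 : |((w 1 - v 1 : ℤ) : ℝ)| ≤ s := by exact_mod_cast h1
  nlinarith [abs_nonneg (((w 0 - v 0 : ℤ) : ℝ)), abs_nonneg (((w 1 - v 1 : ℤ) : ℝ))]

end DiscreteDobrushin

/-! ### Eventually in the mesh: compacts are deep inside -/

open DiscreteDobrushin in
/-- **Deep edges are interior, eventually.** For a discretisation `E` of the Dobrushin domain `D`
(`IsDiscretisation`), a compact `K ⊆ D` and a lattice radius `R`: for all small `δ > 0`, every
edge at every site within sup-distance `R` of a site whose mesh point lies in `K` is an interior
edge of `E δ` (`IsInteriorEdge`: both faces inner, no endpoint on the discrete boundary). The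
input is that compacts of `D` are eventually covered by `meshDomain D δ`
(`JordanDomain.eventually_forall_mem_meshDomain'`, for every Jordan domain) applied to a closed
thickening of `K` inside `D`; lattice segments there lie in `D̄`, so the thickening is a bulk
region. This is the tree's form of "`Q ⊂ Ω` compact, so for `δ` small the squares of `Q` are
interior squares of `Ω_δ`" (Smirnov 2010, §5). [cite: Smirnov2010, §5 (proof of Lemma 5.3, first sentence)] -/
theorem IsDiscretisation.eventually_isInteriorEdge {D : RandomPlanarGeometry.DobrushinDomain} {E : ℝ → DiscreteDobrushin}
    (hDE : IsDiscretisation D E) {K : Set ℂ} (hK : IsCompact K) (hKD : K ⊆ D.carrier) (R : ℕ) :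
    ∀ᶠ δ in 𝓝[>] (0 : ℝ), ∀ x : Site 2, meshPoint δ x ∈ K →
      ∀ y : Site 2, supNear x R y → ∀ k : Fin 4, (E δ).IsInteriorEdge y k := by
  obtain ⟨r, hr, hrD⟩ := hK.exists_cthickening_subset_open D.isOpen hKD
  set K₁ := cthickening (r / 2) K with hK₁def
  have hK₁ : IsCompact K₁ := hK.cthickening
  have hK₁D : K₁ ⊆ D.carrier := (cthickening_mono (by linarith) K).trans hrD
  have h1 : ∀ᶠ δ in 𝓝[>] (0 : ℝ), ∀ z : Site 2, meshPoint δ z ∈ K₁ → z ∈ meshDomain D.carrier δ :=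
    (RandomPlanarGeometry.JordanDomain.eventually_forall_mem_meshDomain' D.toJordanDomain hK₁ hK₁D).mono fun δ h => h.1
  have hc : (0 : ℝ) < r / 2 / (2 * (R + 4)) := by positivity
  have h2 : ∀ᶠ δ in 𝓝[>] (0 : ℝ), δ < r / 2 / (2 * (R + 4)) := nhdsWithin_le_nhds (Iio_mem_nhds hc)
  have h3 : ∀ᶠ δ in 𝓝[>] (0 : ℝ), 0 < δ := self_mem_nhdsWithin
  filter_upwards [h1, h2, h3] with δ hδ1 hδ2 hδ3 x hx y hy k
  have hδR : δ * (2 * ((R : ℤ) + 3 : ℤ)) ≤ r / 2 := by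
    rw [lt_div_iff₀ (by positivity)] at hδ2
    push_cast; nlinarith
  have hδr : 2 * δ ≤ r / 2 := by
    rw [lt_div_iff₀ (by positivity)] at hδ2
    have : (0 : ℝ) ≤ R := Nat.cast_nonneg R
    nlinarith
  -- the bulk region
  set T : Set (Site 2) := {z | meshPoint δ z ∈ K₁} with hT
  have hΩ : (E δ).Ω = D.carrier := hDE.Ω_eq δ
  have hδE : (E δ).δ = δ := hDE.δ_eq δ
  have hbulk : (E δ).IsBulkRegion T := by
    refine ⟨fun z hz => ?_, fun v hv w hw hvw => ?_⟩
    · rw [hΩ, hδE]; exact hδ1 z hz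
    · rw [hΩ, hδE, meshGraph_adj_iff]
      refine ⟨hvw, ?_⟩
      -- the segment lies in `closedBall (meshPoint δ v) δ ⊆ cthickening (δ + r/2) K ⊆ D ⊆ D̄`
      have hdw : dist (meshPoint δ w) (meshPoint δ v) ≤ 2 * δ := by
        have := dist_meshPoint_le_of_supNear hδ3.le (supNear_of_adj hvw)
        push_cast at this; linarith
      have h2δ : 0 ≤ 2 * δ := by linarith
      have hball : closedBall (meshPoint δ v) (2 * δ) ⊆ D.carrier := by
        intro p hp
        have hp' : p ∈ cthickening (2 * δ) K₁ :=
          Metric.mem_cthickening_of_dist_le p (meshPoint δ v) (2 * δ) K₁ hv (mem_closedBall.1 hp)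
        have : cthickening (2 * δ) K₁ ⊆ cthickening r K :=
          (cthickening_cthickening_subset h2δ (by positivity) K).trans (cthickening_mono (by linarith) K)
        exact hrD (this hp')
      refine ((convex_closedBall _ _).segment_subset (mem_closedBall_self h2δ) (mem_closedBall.2 hdw)).trans ?_
      exact hball.trans subset_closure
  -- sites within `3` of `y` lie in `T`
  refine hbulk.isInteriorEdge (fun z hz => ?_) k
  have hxz : supNear x ((R : ℤ) + 3) z := supNear.trans hy hz
  have hdist : dist (meshPoint δ z) (meshPoint δ x) ≤ r / 2 :=
    (dist_meshPoint_le_of_supNear hδ3.le hxz).trans hδR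
  exact Metric.mem_cthickening_of_dist_le _ _ _ _ hx hdist

end Literature.Probability.LatticeModels
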